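import Summits.QuantumFields.YangMills.Theorems.UniversalDetectorHankelPolarisation
import HarnessLib

/-!
# Route `UniversalDetector`, LINE g10-1 «Hankel tightness» — window bounds and the unit time-step of the cross kernel

Ideator seat ym-idea-8 (generation 10, lens «dual»); second toolkit module for the support item
`UniversalDetector.HankelLongitudinal` (stmt-QuantumFields-24001) of rung R2a (`BalabanLadder.NT`).  Route-independent
lattice facts, valid for EVERY compact `G`, every lattice representation `r`, every `β ≥ 0`, every odd torus:

* §11 window bounds: a far-box bound `|Cov_T(P_p(0), P_q(z))| ≤ c` for `z ∈ [-L, L]⁴` with `‖a z‖ ≥ η` bounds the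
  diagonal kernel `D_p(s)` and the cross kernel `X_{p,q,y}(s) = Cov_T(P_p(0), P_q(y + s e₀))` for all times
  `s ∈ [-L, 2L]` whose representative (folded by the period `2L+1` when `s > L`) is `η`-far in time;
* §12 the unit time-step: by `UniversalDetectorHankelPolarisation` (`abs_crossCov_step_le`) window bounds `c₁, c₂, c₃`
  on `D_p, D_q, X` over `[t − k − 1, t + k + 2]` give `|X(t+1) − X(t)| ≤ (3/2)(c₁ + c₂ + 2c₃)/k`; choosing
  `k = ⌊τ/(4a)⌋` for an axially `τ`-separated time `t` (`a t ≳ τ`) and far-box bounds at physical radius `τ/4`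
  gives `|X(t+1) − X(t)| ≤ 12 (a/τ)(c₁ + c₂ + 2c₃)` (`abs_crossCov_succ_sub_le_of_far`).

HONEST FRAMING: helper lemmas only; no summit, rung, crux or item is proved here (the item is closed in
`UniversalDetectorHankelLongitudinal`).  Not Clay.  Refs: Fröhlich–Israel–Lieb–Simon (1978) Thm. 2.1;
Glimm–Jaffe (1987) §6.1 [folklore].
-/

set_option autoImplicit false

noncomputable section

open MeasureTheory Filter Topology
open Literature.MathematicalPhysics.QuantumFieldTheory Literature.MathematicalPhysics.QuantumLattice
  Literature.Probability.LatticeModels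
open Summit.QuantumFields.YangMills.Cruxes.OSLegsFromFemtoAndGap.DlrCollarTransfer
open Summit.QuantumFields.YangMills.Cruxes.UniversalDetectorPlaneTight (cov_plane_add_period)

namespace Summit.QuantumFields.YangMills.Cruxes.UniversalDetectorHankel

variable (G : Type) [Group G] [TopologicalSpace G] [IsTopologicalGroup G] [CompactSpace G]
  [MeasurableSpace G] [BorelSpace G] (r : LatticeRep G)

/-! ## §11 Window bounds from far-box bounds (periodic folding in time) -/

omit [Group G] [TopologicalSpace G] [IsTopologicalGroup G] [CompactSpace G] [MeasurableSpace G] [BorelSpace G] in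
/-- A lower bound on the rescaled time coordinate is a lower bound on the rescaled Euclidean norm. [folklore] -/
theorem le_norm_smul_siteToE_of_le_time {a η : ℝ} (ha : 0 ≤ a) (w : Site 4) (h : η ≤ a * |(w 0 : ℝ)|) :
    η ≤ ‖a • siteToE w‖ := by
  refine h.trans ?_
  calc a * |(w 0 : ℝ)| = ‖(a • siteToE w) 0‖ := by simp [Real.norm_eq_abs, abs_of_nonneg ha]
    _ ≤ ‖a • siteToE w‖ := PiLp.norm_apply_le _ 0

omit [Group G] [TopologicalSpace G] [IsTopologicalGroup G] [CompactSpace G] [MeasurableSpace G] [BorelSpace G] in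
/-- Folding a time in `(L, 2L]` back into the box: `Pi.single 0 (s − (2L+1)) + (2L+1)•e₀ = Pi.single 0 s`. -/
theorem single_fold (L : ℕ) (s : ℤ) :
    (Pi.single 0 (s - ((2 * L + 1 : ℕ) : ℤ)) : Site 4) + (((2 * L + 1 : ℕ) : ℤ)) • (Pi.single 0 1 : Site 4) =
      Pi.single 0 s := by
  rw [← Pi.single_smul, ← Pi.single_add]
  congr 1
  rw [smul_eq_mul, mul_one, sub_add_cancel]

/-- **Diagonal window bound.**  A far-box bound `|Cov_T(P_p(0), P_p(z))| ≤ c` (`z ∈ box`, `‖a z‖ ≥ η`) bounds the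
diagonal kernel `D_p(s)` at every time `s ∈ [−L, 2L]` whose box representative is `η`-far (times beyond `L` are
folded by the period `2L+1`). [folklore] -/
theorem abs_diagCov_le_of_far {β : ℝ} {L : ℕ} {p : Fin 4 × Fin 4} {a η c : ℝ} (ha : 0 ≤ a)
    (hfar : ∀ z ∈ box 4 L, η ≤ ‖a • siteToE z‖ →
      |torusE G r β L (fun U => plane G r p 0 U * plane G r p z U) -
          torusE G r β L (plane G r p 0) * torusE G r β L (plane G r p z)| ≤ c)
    {s : ℤ} (hs0 : -(L : ℤ) ≤ s) (hs2 : s ≤ 2 * L) (hη1 : s ≤ L → η ≤ a * |(s : ℝ)|)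
    (hη2 : (L : ℤ) < s → η ≤ a * |((s - ((2 * L + 1 : ℕ) : ℤ) : ℤ) : ℝ)|) : |diagCov G r β L p s| ≤ c := by
  by_cases hsL : s ≤ L
  · have hmem : (Pi.single 0 s : Site 4) ∈ box 4 L := by
      simp only [box, Fintype.mem_piFinset, Finset.mem_Icc]
      intro i
      by_cases hi : i = 0
      · subst hi; rw [Pi.single_eq_same]; exact ⟨hs0, hsL⟩
      · rw [Pi.single_eq_of_ne hi]; constructor <;> omega
    exact hfar _ hmem (le_norm_smul_siteToE_of_le_time ha _ (by rw [Pi.single_eq_same]; exact hη1 hsL))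
  · push Not at hsL
    have hmem : (Pi.single 0 (s - ((2 * L + 1 : ℕ) : ℤ)) : Site 4) ∈ box 4 L := by
      simp only [box, Fintype.mem_piFinset, Finset.mem_Icc]
      intro i
      by_cases hi : i = 0
      · subst hi; rw [Pi.single_eq_same]; push_cast; constructor <;> omega
      · rw [Pi.single_eq_of_ne hi]; constructor <;> omega
    have h := hfar _ hmem (le_norm_smul_siteToE_of_le_time ha _ (by rw [Pi.single_eq_same]; exact hη2 hsL))
    have hper := diagCov_add_period G r β L p (s - ((2 * L + 1 : ℕ) : ℤ))
    rw [sub_add_cancel] at hper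
    rw [hper]
    exact h

/-- **Cross window bound.**  The same for the cross kernel `X_{p,q,y}(s) = Cov_T(P_p(0), P_q(y + s e₀))` above a
spatial offset `y` in the box (`y₀ = 0`). [folklore] -/
theorem abs_crossCov_le_of_far {β : ℝ} {L : ℕ} {p q : Fin 4 × Fin 4} {a η c : ℝ} (ha : 0 ≤ a)
    (hfar : ∀ z ∈ box 4 L, η ≤ ‖a • siteToE z‖ →
      |torusE G r β L (fun U => plane G r p 0 U * plane G r q z U) -
          torusE G r β L (plane G r p 0) * torusE G r β L (plane G r q z)| ≤ c)
    {y : Site 4} (hy : y 0 = 0) (hyL : ∀ i, -(L : ℤ) ≤ y i ∧ y i ≤ L)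
    {s : ℤ} (hs0 : -(L : ℤ) ≤ s) (hs2 : s ≤ 2 * L) (hη1 : s ≤ L → η ≤ a * |(s : ℝ)|)
    (hη2 : (L : ℤ) < s → η ≤ a * |((s - ((2 * L + 1 : ℕ) : ℤ) : ℤ) : ℝ)|) : |crossCov G r β L p q y s| ≤ c := by
  have hcoord : ∀ (s' : ℤ) (i : Fin 4), (y + (Pi.single 0 s' : Site 4)) i = if i = 0 then s' else y i := by
    intro s' i
    by_cases hi : i = 0
    · subst hi; simp [hy]
    · simp [hi]
  by_cases hsL : s ≤ L
  · have hmem : y + (Pi.single 0 s : Site 4) ∈ box 4 L := by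
      simp only [box, Fintype.mem_piFinset, Finset.mem_Icc]
      intro i
      rw [hcoord s i]
      split_ifs
      · exact ⟨hs0, hsL⟩
      · exact hyL i
    exact hfar _ hmem (le_norm_smul_siteToE_of_le_time ha _ (by rw [hcoord s 0, if_pos rfl]; exact hη1 hsL))
  · push Not at hsL
    have hmem : y + (Pi.single 0 (s - ((2 * L + 1 : ℕ) : ℤ)) : Site 4) ∈ box 4 L := by
      simp only [box, Fintype.mem_piFinset, Finset.mem_Icc]
      intro i
      rw [hcoord _ i]
      split_ifs
      · push_cast; constructor <;> omega
      · exact hyL i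
    have h := hfar _ hmem (le_norm_smul_siteToE_of_le_time ha _ (by
      rw [hcoord _ 0, if_pos rfl]; exact hη2 hsL))
    have hper := cov_plane_add_period r β L p q 0 (y + Pi.single 0 (s - ((2 * L + 1 : ℕ) : ℤ))) (Pi.single 0 1)
    rw [add_assoc, single_fold] at hper
    unfold crossCov
    rw [hper]
    exact h

/-! ## §12 The unit time-step of the cross kernel -/

/-- **Unit-step bound from window bounds.**  If `D_p`, `D_q`, `X_{p,q,y}` are bounded by `c₁, c₂, c₃` on the time
window `[t − k − 1, t + k + 2]` (`k ≥ 1`, `k + 1 ≤ t`, `t + k + 6 ≤ 2L`), then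
`|X(t+1) − X(t)| ≤ (3/2)(c₁ + c₂ + 2c₃)/k`. [cite: GlimmJaffe1987, §6.1] -/
theorem abs_crossCov_succ_sub_le {β : ℝ} (hβ : 0 ≤ β) {L : ℕ} (hL : 1 ≤ L) {p q : Fin 4 × Fin 4} (hp : p.1 < p.2)
    (hq : q.1 < q.2) (y : Site 4) (hy : y 0 = 0) {t : ℤ} {k : ℕ} (hk : 1 ≤ k) (ht : (k : ℤ) + 1 ≤ t)
    (htL : t + k + 6 ≤ 2 * L) {c₁ c₂ c₃ : ℝ}
    (h₁ : ∀ s : ℤ, t - k - 1 ≤ s → s ≤ t + k + 2 → |diagCov G r β L p s| ≤ c₁)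
    (h₂ : ∀ s : ℤ, t - k - 1 ≤ s → s ≤ t + k + 2 → |diagCov G r β L q s| ≤ c₂)
    (h₃ : ∀ s : ℤ, t - k - 1 ≤ s → s ≤ t + k + 2 → |crossCov G r β L p q y s| ≤ c₃) :
    |crossCov G r β L p q y (t + 1) - crossCov G r β L p q y t| ≤ 3 / 2 * (c₁ + c₂ + 2 * c₃) / k := by
  have hδ0 := elec_nonneg p
  have hδ1 := elec_le_one p
  have hε0 := elec_nonneg q
  have hε1 := elec_le_one q
  obtain ⟨m, hm⟩ : ∃ m : ℕ, (m : ℤ) = t - elec p := ⟨(t - elec p).toNat, Int.toNat_of_nonneg (by omega)⟩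
  have hSW : ∀ n : ℕ, m - k ≤ n → n ≤ m + 1 + k → pairMirror G r β L p q y n ≤ c₁ + c₂ + 2 * c₃ := by
    intro n hn1 hn2
    rw [pairMirror_eq G r β L hp hq y hy n]
    have b1 := h₁ ((n : ℤ) + elec p) (by omega) (by omega)
    have b2 := h₂ ((n : ℤ) + elec q) (by omega) (by omega)
    have b3 := h₃ ((n : ℤ) + elec p) (by omega) (by omega)
    linarith [le_abs_self (diagCov G r β L p ((n : ℤ) + elec p)), le_abs_self (diagCov G r β L q ((n : ℤ) + elec q)),
      le_abs_self (crossCov G r β L p q y ((n : ℤ) + elec p))]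
  have hSp : ∀ n : ℕ, m - k ≤ n → n ≤ m + 1 + k → diagCov G r β L p ((n : ℤ) + elec p) ≤ c₁ + c₂ + 2 * c₃ := by
    intro n hn1 hn2
    have b1 := h₁ ((n : ℤ) + elec p) (by omega) (by omega)
    have b2 := h₂ ((n : ℤ) + elec q) (by omega) (by omega)
    have b3 := h₃ ((n : ℤ) + elec p) (by omega) (by omega)
    linarith [le_abs_self (diagCov G r β L p ((n : ℤ) + elec p)), abs_nonneg (diagCov G r β L q ((n : ℤ) + elec q)),
      abs_nonneg (crossCov G r β L p q y ((n : ℤ) + elec p))]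
  have hSq : ∀ n : ℕ, m - k ≤ n → n ≤ m + 1 + k → diagCov G r β L q ((n : ℤ) + elec q) ≤ c₁ + c₂ + 2 * c₃ := by
    intro n hn1 hn2
    have b1 := h₁ ((n : ℤ) + elec p) (by omega) (by omega)
    have b2 := h₂ ((n : ℤ) + elec q) (by omega) (by omega)
    have b3 := h₃ ((n : ℤ) + elec p) (by omega) (by omega)
    linarith [abs_nonneg (diagCov G r β L p ((n : ℤ) + elec p)), le_abs_self (diagCov G r β L q ((n : ℤ) + elec q)),
      abs_nonneg (crossCov G r β L p q y ((n : ℤ) + elec p))]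
  have key := abs_crossCov_step_le G r hβ hL hp hq y hy (A := m - k) (B := m + 1 + k) (by omega) hSW hSp hSq
    (m := m) (k := k) hk (by omega) le_rfl
  rw [show ((m + 1 : ℕ) : ℤ) + elec p = t + 1 by push_cast; omega, show (m : ℤ) + elec p = t by omega] at key
  exact key

/-- **Unit time-step bound from far-box bounds**, with the window half-width `k = ⌊τ/(4a)⌋` drawn from the axial
separation `a·t ≳ τ`: `|X(t+1) − X(t)| ≤ 12·(a/τ)·(c₁ + c₂ + 2c₃)`. [cite: GlimmJaffe1987, §6.1] -/
theorem abs_crossCov_succ_sub_le_of_far {β : ℝ} (hβ : 0 ≤ β) {L : ℕ} (hL : 1 ≤ L) {p q : Fin 4 × Fin 4}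
    (hp : p.1 < p.2) (hq : q.1 < q.2) {y : Site 4} (hy : y 0 = 0) (hyL : ∀ i, -(L : ℤ) ≤ y i ∧ y i ≤ L)
    {a τ c₁ c₂ c₃ : ℝ} (ha : 0 < a) (haτ : a ≤ τ / 8) (ha1 : a ≤ 1) (haL : τ / 2 + 7 ≤ a * L)
    (h₁ : ∀ z ∈ box 4 L, τ / 4 ≤ ‖a • siteToE z‖ →
      |torusE G r β L (fun U => plane G r p 0 U * plane G r p z U) -
          torusE G r β L (plane G r p 0) * torusE G r β L (plane G r p z)| ≤ c₁)
    (h₂ : ∀ z ∈ box 4 L, τ / 4 ≤ ‖a • siteToE z‖ →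
      |torusE G r β L (fun U => plane G r q 0 U * plane G r q z U) -
          torusE G r β L (plane G r q 0) * torusE G r β L (plane G r q z)| ≤ c₂)
    (h₃ : ∀ z ∈ box 4 L, τ / 4 ≤ ‖a • siteToE z‖ →
      |torusE G r β L (fun U => plane G r p 0 U * plane G r q z U) -
          torusE G r β L (plane G r p 0) * torusE G r β L (plane G r q z)| ≤ c₃)
    {t : ℤ} (ht1 : τ / a - 1 ≤ (t : ℝ)) (ht2 : t ≤ (L : ℤ)) :
    |crossCov G r β L p q y (t + 1) - crossCov G r β L p q y t| ≤ 12 * (a / τ) * (c₁ + c₂ + 2 * c₃) := by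
  have hτ : 0 < τ := by linarith
  set k : ℕ := ⌊τ / (4 * a)⌋₊ with hkdef
  have hx0 : 0 ≤ τ / (4 * a) := by positivity
  have hx2 : 2 ≤ τ / (4 * a) := by rw [le_div_iff₀ (by positivity)]; linarith
  have hk1 : 1 ≤ k := Nat.le_floor (by push_cast; linarith)
  have hkle : (k : ℝ) ≤ τ / (4 * a) := Nat.floor_le hx0
  have hklt : τ / (4 * a) < k + 1 := Nat.lt_floor_add_one _
  have hkpos : (0 : ℝ) < k := by exact_mod_cast hk1
  -- `a k ≤ τ/4`, `τ ≤ 8 a k`, `τ ≤ a (t + 1)`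
  have hak : a * k ≤ τ / 4 := by
    have h := mul_le_mul_of_nonneg_left hkle ha.le
    have e : a * (τ / (4 * a)) = τ / 4 := by field_simp
    linarith
  have hak' : τ ≤ 8 * (a * k) := by
    have h : τ / (4 * a) - 1 < k := by linarith
    have h' := mul_lt_mul_of_pos_left h ha
    have e : a * (τ / (4 * a) - 1) = τ / 4 - a := by field_simp
    linarith
  have hat : τ - a ≤ a * t := by
    have h := mul_le_mul_of_nonneg_left ht1 ha.le
    have e : a * (τ / a - 1) = τ - a := by field_simp
    linarith
  -- integer consequences
  have ht4 : 4 * (k : ℤ) ≤ t + 1 := by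
    have h : 4 * (a * k) ≤ a * (t + 1) := by linarith
    have h' : (4 * k : ℝ) ≤ (t : ℝ) + 1 := by nlinarith
    exact_mod_cast h'
  have htk : (k : ℤ) + 1 ≤ t := by omega
  have hkL : (k : ℤ) + 6 < L := by
    have h : a * ((k : ℝ) + 6) < a * L := by nlinarith
    have h' : (k : ℝ) + 6 < L := lt_of_mul_lt_mul_left h ha.le
    exact_mod_cast h'
  have htL : t + k + 6 ≤ 2 * L := by omega
  -- window farness
  have hfar1 : ∀ s : ℤ, t - k - 1 ≤ s → s ≤ L → τ / 4 ≤ a * |(s : ℝ)| := by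
    intro s hs _
    have hs' : (t : ℝ) - k - 1 ≤ s := by exact_mod_cast hs
    have hs1 : (1 : ℤ) ≤ s := by omega
    have hspos : (0 : ℝ) ≤ s := by exact_mod_cast (show (0 : ℤ) ≤ s by omega)
    rw [abs_of_nonneg hspos]
    have h := mul_le_mul_of_nonneg_left hs' ha.le
    linarith
  have hfar2 : ∀ s : ℤ, s ≤ t + k + 2 → (L : ℤ) < s → τ / 4 ≤ a * |((s - ((2 * L + 1 : ℕ) : ℤ) : ℤ) : ℝ)| := by
    intro s hs hLs
    have hneg : ((s - ((2 * L + 1 : ℕ) : ℤ) : ℤ) : ℝ) ≤ 0 := by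
      exact_mod_cast (show s - ((2 * L + 1 : ℕ) : ℤ) ≤ 0 by push_cast; omega)
    rw [abs_of_nonpos hneg]
    have hs' : (s : ℝ) ≤ t + k + 2 := by exact_mod_cast hs
    have ht2' : (t : ℝ) ≤ L := by exact_mod_cast ht2
    have h := mul_le_mul_of_nonneg_left hs' ha.le
    have h' := mul_le_mul_of_nonneg_left ht2' ha.le
    push_cast
    linarith
  -- the window bounds
  have b₁ : ∀ s : ℤ, t - k - 1 ≤ s → s ≤ t + k + 2 → |diagCov G r β L p s| ≤ c₁ := fun s hs1 hs2 =>
    abs_diagCov_le_of_far G r ha.le h₁ (by omega) (by omega) (fun hsL => hfar1 s hs1 hsL)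
      (fun hLs => hfar2 s hs2 hLs)
  have b₂ : ∀ s : ℤ, t - k - 1 ≤ s → s ≤ t + k + 2 → |diagCov G r β L q s| ≤ c₂ := fun s hs1 hs2 =>
    abs_diagCov_le_of_far G r ha.le h₂ (by omega) (by omega) (fun hsL => hfar1 s hs1 hsL)
      (fun hLs => hfar2 s hs2 hLs)
  have b₃ : ∀ s : ℤ, t - k - 1 ≤ s → s ≤ t + k + 2 → |crossCov G r β L p q y s| ≤ c₃ := fun s hs1 hs2 =>
    abs_crossCov_le_of_far G r ha.le h₃ hy hyL (by omega) (by omega) (fun hsL => hfar1 s hs1 hsL)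
      (fun hLs => hfar2 s hs2 hLs)
  have key := abs_crossCov_succ_sub_le G r hβ hL hp hq y hy hk1 htk htL b₁ b₂ b₃
  have hcs : 0 ≤ c₁ + c₂ + 2 * c₃ := by
    have e1 := b₁ t (by omega) (by omega)
    have e2 := b₂ t (by omega) (by omega)
    have e3 := b₃ t (by omega) (by omega)
    linarith [abs_nonneg (diagCov G r β L p t), abs_nonneg (diagCov G r β L q t), abs_nonneg (crossCov G r β L p q y t)]
  refine key.trans ?_
  rw [div_le_iff₀ hkpos]
  have h32 : 3 / 2 ≤ 12 * (a / τ) * k := by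
    rw [show 12 * (a / τ) * k = 12 * (a * k) / τ by ring, le_div_iff₀ hτ]
    linarith
  nlinarith [h32, hcs]

end Summit.QuantumFields.YangMills.Cruxes.UniversalDetectorHankel

end
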